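import Mathlib
import HarnessLib
import Literature.Analysis.FluidPDE.ClassicalSolution
import Literature.Analysis.FluidPDE.LerayHopf
import Literature.Analysis.FluidPDE.SuitableWeak
import Literature.Analysis.FluidPDE.TaoLocalisationHolds
import Literature.Analysis.FluidPDE.TaoFiniteEnergyLerayHopf
import Literature.Analysis.FluidPDE.BKMClassGradientContinuity
import Summits.NavierStokesRegularity.NavierStokesRegularity.Theses.HalfHolderEnergy
import Summits.NavierStokesRegularity.NavierStokesRegularity.Theorems.QuarterJoltDissipationRateEnergyEquality
import Summits.NavierStokesRegularity.NavierStokesRegularity.Theorems.QuarterJoltTypeIIEnergyEqualityEdges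
import Summits.NavierStokesRegularity.NavierStokesRegularity.Theorems.QuarterJoltNoEnergyAtom
import Summits.NavierStokesRegularity.NavierStokesRegularity.Theorems.CertifiedBlowupCertifiedBlowupAxisymBlowupEnergyDrain

/-!
# Route QuarterJolt — crux `NoTerminalJolt` (stmt-NavierStokesRegularity-26463), LEAD line
# `regular_split` rev 8: ENERGY `γ`-HÖLDER AT `T⁻` (`γ > 1/5`) ⇒ ENERGY CONTINUOUS AT `T`; the
# window quarter law `EnergyHalfHolder` (stmt-25161) ⇒ `NoFastEnergyConcentration` (stmt-18118) BY NAME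

Seat ns-ntj-p1 g6 (LEAD of the crux; `--supports 26463 --as helper`). Companion of
`QuarterJoltDissipationRateEnergyEquality.lean` (the dissipation-tail theorem: in the frame,
`∫⁻_{(t,T)}∫⁻|Du|²_F ≤ K(T−t)^γ` near `T` with `1/5 < γ ≤ 1` ⇒ no energy jump at `T`).

* `tendsto_eLpNorm_sub_of_dissipationRate` — `eLpNorm` form;
  `tendsto_integral_norm_sub_sq_of_energyHolder` — ENERGY FORM: `E(u t) − E(u s) ≤ K(T−t)^γ` for
  all `t < s < T` with `t` near `T`, `1/5 < γ ≤ 1`, ⇒ `∫‖u(t) − u(T)‖² → 0` («energy `γ`-Hölder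
  from the left at a first blow-up with `γ > 1/5` ⇒ no anomalous dissipation at the blow-up
  instant»; Leray's rate forces `γ ≤ 1/2`).
* `typeIIEnergyEquality_of_energyHalfHolder` — the WINDOW QUARTER LAW `EnergyHalfHolder` of route
  HalfHolderEnergy (stmt-25161: `∫ₐᵇ∫|curl u|² ≤ K√(b−a)` on `[0,T]` at a first blow-up) is the case
  `γ = 1/2` (curl ↔ full gradient by `lintegral_frobeniusNormSq_fderiv_eq_lintegral_curl_sq` on
  Tao-class slabs), hence implies the former stub 3 of `Cruxes/NoTerminalJolt/Lines/regular_split.lean`;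
  **`noFastEnergyConcentration_of_energyHalfHolder : EnergyHalfHolder → NoFastEnergyConcentration`**
  (stmt-25161 ⇒ stmt-18118 BY NAME — a typed edge between two shelf records of different routes)
  and `noEnergyAtom_of_energyHalfHolder` (stmt-25161 ⇒ WeakLambdaCriterion's `stub_noEnergyAtom`,
  crux stmt-19625, VERBATIM).

HONEST FRAMING: conditional statements; `EnergyHalfHolder`, `NoFastEnergyConcentration`,
`NoTerminalJolt` and Navier–Stokes regularity are all OPEN; nothing is asserted about them. No summit
statement is proved here. [folklore]
-/

noncomputable section

-- the summit and its single sub-problem share the name (CONVENTIONS §1), as in every Theorems file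
set_option linter.dupNamespace false

namespace Summit.NavierStokesRegularity.NavierStokesRegularity.Theorems

open MeasureTheory Set Function Filter Topology InnerProductSpace
open scoped ENNReal NNReal ContDiff RealInnerProductSpace
open Literature.Analysis.FluidPDE

namespace NoTerminalJolt

/-! ### Forms of the dissipation-tail theorem -/

/-- **Dissipation tail `≤ K(T−t)^γ`, `γ > 1/5` ⇒ no energy jump, `eLpNorm` form.** [folklore] -/
theorem tendsto_eLpNorm_sub_of_dissipationRate {ν T : ℝ} (hν : 0 < ν) (hT : 0 < T)
    {u : ℝ → EuclideanSpace ℝ (Fin 3) → EuclideanSpace ℝ (Fin 3)} {p : ℝ → EuclideanSpace ℝ (Fin 3) → ℝ}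
    (hcl : IsClassicalNSSolutionOn (Ico 0 T) ν 0 u p) (hLH : IsLerayHopfOn T ν 0 (u 0) u)
    (hdec : HasRapidSpatialDecay (u 0)) {K γ : ℝ} (hK : 0 ≤ K) (hγ : 1 / 5 < γ) (hγ1 : γ ≤ 1)
    (hD : ∀ᶠ t in 𝓝[<] T, ∫⁻ τ in Ioo t T, ∫⁻ x, ENNReal.ofReal (frobeniusNormSq (fderiv ℝ (u τ) x)) ≤
      ENNReal.ofReal (K * (T - t) ^ γ)) :
    Tendsto (fun t => eLpNorm (u t - u T) 2 volume) (𝓝[<] T) (𝓝 0) :=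
  (tendsto_eLpNorm_sub_iff_tendsto_integral_norm_sub_sq hT hLH).2
    (tendsto_integral_norm_sub_sq_of_dissipationRate hν hT hcl hLH hdec hK hγ hγ1 hD)

/-- **ENERGY `γ`-HÖLDER AT `T⁻` WITH `γ > 1/5` ⇒ ENERGY CONTINUOUS AT `T`.** In the frame, if
`E(u t) − E(u s) ≤ K(T−t)^γ` for all `t < s < T` with `t` near `T` (`K ≥ 0`, `1/5 < γ ≤ 1`), then
`∫‖u(t) − u(T)‖² → 0` as `t ↑ T`: no anomalous dissipation at the blow-up instant. (The energy drop on
`(t,s)` dominates `ν∫ₜˢ∫|Du|²_F`, `EnergyDrain.dissipation_le_energy_sub`; then the dissipation-tail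
theorem.) Leray's rate forces `γ ≤ 1/2` at a genuine blow-up. [folklore] -/
theorem tendsto_integral_norm_sub_sq_of_energyHolder {ν T : ℝ} (hν : 0 < ν) (hT : 0 < T)
    {u : ℝ → EuclideanSpace ℝ (Fin 3) → EuclideanSpace ℝ (Fin 3)} {p : ℝ → EuclideanSpace ℝ (Fin 3) → ℝ}
    (hcl : IsClassicalNSSolutionOn (Ico 0 T) ν 0 u p) (hLH : IsLerayHopfOn T ν 0 (u 0) u)
    (hdec : HasRapidSpatialDecay (u 0)) {K γ : ℝ} (hK : 0 ≤ K) (hγ : 1 / 5 < γ) (hγ1 : γ ≤ 1)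
    (hE : ∀ᶠ t in 𝓝[<] T, ∀ s ∈ Ioo t T,
      VectorCalculus.kineticEnergy (u t) - VectorCalculus.kineticEnergy (u s) ≤ K * (T - t) ^ γ) :
    Tendsto (fun t => ∫ x, ‖u t x - u T x‖ ^ 2) (𝓝[<] T) (𝓝 0) := by
  have hwin : ∀ᶠ t in 𝓝[<] T, t ∈ Ioo 0 T := Ioo_mem_nhdsLT hT
  refine tendsto_integral_norm_sub_sq_of_dissipationRate hν hT hcl hLH hdec
    (div_nonneg hK hν.le : 0 ≤ K / ν) hγ hγ1 ?_
  filter_upwards [hE, hwin] with t ht htI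
  have hpos : 0 ≤ K / ν * (T - t) ^ γ :=
    mul_nonneg (div_nonneg hK hν.le) (Real.rpow_nonneg (sub_nonneg.2 htI.2.le) _)
  refine lintegral_Ioo_le_of_forall_Ioo_le htI.2 fun s hs => ?_
  obtain ⟨hfin, hle⟩ := CertifiedBlowupAxisymBlowup.EnergyDrain.dissipation_le_energy_sub hν hcl hLH
    htI.1.le hs.1.le hs.2.le
  have hle' : (∫⁻ τ in Ioo t s, ∫⁻ x, ENNReal.ofReal (frobeniusNormSq (fderiv ℝ (u τ) x))).toReal ≤
      K / ν * (T - t) ^ γ := by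
    rw [div_mul_eq_mul_div, le_div_iff₀ hν, mul_comm]
    exact hle.trans (ht s hs)
  exact (ENNReal.le_ofReal_iff_toReal_le hfin hpos).2 hle'

/-! ### The window quarter law (stmt-25161) decides the energy half -/

/-- In the frame, the enstrophy in curl form equals the Frobenius dissipation density slice by
slice: `∫⁻ ofReal |Du(τ)|²_F = ∫⁻ ‖curl u(τ)‖ₑ²` for `τ ∈ [0,T)` (Tao's class on the closed slab
`[0,(τ+T)/2]` supplies `u(τ), Du(τ), D²u(τ) ∈ L²`; `lintegral_frobeniusNormSq_fderiv_eq_lintegral_curl_sq`).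
[folklore] -/
theorem lintegral_frobeniusNormSq_eq_lintegral_curl_sq_of_frame {ν T : ℝ} (hν : 0 < ν)
    {u : ℝ → EuclideanSpace ℝ (Fin 3) → EuclideanSpace ℝ (Fin 3)} {p : ℝ → EuclideanSpace ℝ (Fin 3) → ℝ}
    (hcl : IsClassicalNSSolutionOn (Ico 0 T) ν 0 u p) (hLH : IsLerayHopfOn T ν 0 (u 0) u)
    (hdec : HasRapidSpatialDecay (u 0)) {τ : ℝ} (hτ : τ ∈ Ico 0 T) :
    ∫⁻ x, ENNReal.ofReal (frobeniusNormSq (fderiv ℝ (u τ) x)) = ∫⁻ x, ‖curl (u τ) x‖ₑ ^ 2 := by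
  set S : ℝ := (τ + T) / 2 with hSdef
  have hτS : τ < S := by rw [hSdef]; linarith [hτ.2]
  have hST : S < T := by rw [hSdef]; linarith [hτ.2]
  have hS : 0 < S := lt_of_le_of_lt hτ.1 hτS
  have hsolS : IsClassicalNSSolutionOn (Icc 0 S) ν 0 u p :=
    hcl.mono (Icc_subset_Ico_right hST) (uniqueDiffOn_Icc hS)
  have hE' : ∃ C' : ℝ≥0, ∀ σ ∈ Icc 0 S, ∫⁻ x, ‖u σ x‖ₑ ^ 2 ≤ C' :=
    ⟨(ENNReal.ofReal (2 * VectorCalculus.kineticEnergy (u 0))).toNNReal, fun σ hσ => by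
      rw [ENNReal.coe_toNNReal ENNReal.ofReal_ne_top]
      exact hLH.lintegral_enorm_sq_le hν.le ⟨hσ.1, hσ.2.trans hST.le⟩⟩
  have hB : HasBoundedSobolevNormsOn (Icc 0 S) u :=
    tao2011_hasBoundedSobolevNormsOn_holds hν hS hsolS hE' hdec
  have hτI : τ ∈ Icc 0 S := ⟨hτ.1, hτS.le⟩
  have hsm : ContDiff ℝ 2 (u τ) := (hcl.contDiff_velocity hτ).of_le (by norm_cast)
  have hn : ∀ n : ℕ, ∫⁻ x, ‖iteratedFDeriv ℝ n (u τ) x‖ₑ ^ 2 < ⊤ := fun n => by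
    obtain ⟨C, hC⟩ := hB n
    exact (hC τ hτI).trans_lt ENNReal.coe_lt_top
  have h0 : ∫⁻ x, ‖u τ x‖ₑ ^ 2 < ⊤ := by
    refine lt_of_le_of_lt (le_of_eq (lintegral_congr fun x => ?_)) (hn 0)
    rw [← ofReal_norm, ← norm_iteratedFDeriv_zero (𝕜 := ℝ) (f := u τ), ofReal_norm]
  exact lintegral_frobeniusNormSq_fderiv_eq_lintegral_curl_sq hsm (hcl.divFree τ hτ) h0 (hn 1) (hn 2)

/-- **`EnergyHalfHolder ⇒` the former stub 3 (`TypeIIEnergyEquality`)**: under the window quarter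
law of route HalfHolderEnergy (stmt-25161 BY NAME) a first blow-up in the frame has no energy jump
(dissipation-tail theorem with `γ = 1/2`; the hypothesis `¬ IsTypeIBlowup` is not used). Conditional
on the OPEN crux stmt-25161. [folklore] -/
theorem typeIIEnergyEquality_of_energyHalfHolder
    (hH : Theses.HalfHolderEnergy.EnergyHalfHolder) :
    ∀ (ν T : ℝ), 0 < ν → 0 < T →
      ∀ (u : ℝ → EuclideanSpace ℝ (Fin 3) → EuclideanSpace ℝ (Fin 3))
        (p : ℝ → EuclideanSpace ℝ (Fin 3) → ℝ),
        Literature.Analysis.FluidPDE.IsMaximalSmoothSolution ν 0 u p T →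
        Literature.Analysis.FluidPDE.IsLerayHopfOn T ν 0 (u 0) u →
        Literature.Analysis.FluidPDE.HasRapidSpatialDecay (u 0) →
        ¬ Literature.Analysis.FluidPDE.IsTypeIBlowup u T →
        Filter.Tendsto (fun t => MeasureTheory.eLpNorm (u t - u T) 2 MeasureTheory.volume)
          (nhdsWithin T (Set.Iio T)) (nhds 0) := by
  intro ν T hν hT u p hmax hLH hdec _
  obtain ⟨K, hK⟩ := hH ν T hν hT u p hmax hLH hdec
  set K' : ℝ := max K 0 with hK'
  have hK'0 : 0 ≤ K' := le_max_right _ _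
  refine tendsto_eLpNorm_sub_of_dissipationRate hν hT hmax.1 hLH hdec hK'0
    (by norm_num : (1:ℝ) / 5 < 1 / 2) (by norm_num : (1:ℝ) / 2 ≤ 1) ?_
  have hwin : ∀ᶠ t in 𝓝[<] T, t ∈ Ioo 0 T := Ioo_mem_nhdsLT hT
  filter_upwards [hwin] with t htI
  have h := hK t T htI.1.le htI.2.le le_rfl
  have heq : ∫⁻ τ in Ioo t T, ∫⁻ x, ENNReal.ofReal (frobeniusNormSq (fderiv ℝ (u τ) x)) =
      ∫⁻ τ in Ioo t T, ∫⁻ x, ‖curl (u τ) x‖ₑ ^ 2 :=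
    setLIntegral_congr_fun measurableSet_Ioo fun τ hτ =>
      lintegral_frobeniusNormSq_eq_lintegral_curl_sq_of_frame hν hmax.1 hLH hdec
        ⟨htI.1.le.trans hτ.1.le, hτ.2⟩
  rw [heq]
  refine h.trans (ENNReal.ofReal_le_ofReal ?_)
  rw [← Real.sqrt_eq_rpow]
  exact mul_le_mul_of_nonneg_right (le_max_left _ _) (Real.sqrt_nonneg _)

/-- **`EnergyHalfHolder ⇒` NO ENERGY JUMP AT ANY FIRST BLOW-UP** (no Type-I/II case distinction).
Conditional on stmt-25161. [folklore] -/
theorem energyEqualityAtBlowup_of_energyHalfHolder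
    (hH : Theses.HalfHolderEnergy.EnergyHalfHolder) :
    ∀ (ν T : ℝ), 0 < ν → 0 < T →
      ∀ (u : ℝ → EuclideanSpace ℝ (Fin 3) → EuclideanSpace ℝ (Fin 3))
        (p : ℝ → EuclideanSpace ℝ (Fin 3) → ℝ),
        Literature.Analysis.FluidPDE.IsMaximalSmoothSolution ν 0 u p T →
        Literature.Analysis.FluidPDE.IsLerayHopfOn T ν 0 (u 0) u →
        Literature.Analysis.FluidPDE.HasRapidSpatialDecay (u 0) →
        Filter.Tendsto (fun t => MeasureTheory.eLpNorm (u t - u T) 2 MeasureTheory.volume)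
          (nhdsWithin T (Set.Iio T)) (nhds 0) :=
  typeIIEnergyEquality_iff_energyEqualityAtBlowup.1 (typeIIEnergyEquality_of_energyHalfHolder hH)

/-- **`EnergyHalfHolder ⇒ NoFastEnergyConcentration`** (crux stmt-25161 of route HalfHolderEnergy
BY NAME ⇒ shelf statement stmt-18118 `HodographBetchov.NoFastEnergyConcentration` BY NAME): the
window quarter law at first blow-ups forces energy continuity there (dissipation-tail theorem,
`γ = 1/2 > 1/5`), and «energy continuity at every frame time» is 18118
(`noFastEnergyConcentration_of_typeIIEnergyEquality`, p642789). A typed edge between two shelf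
records; both statements OPEN, nothing is asserted about them. [folklore] -/
theorem noFastEnergyConcentration_of_energyHalfHolder
    (hH : Theses.HalfHolderEnergy.EnergyHalfHolder) :
    Theses.HodographBetchov.NoFastEnergyConcentration :=
  noFastEnergyConcentration_of_typeIIEnergyEquality (typeIIEnergyEquality_of_energyHalfHolder hH)

/-- **`EnergyHalfHolder ⇒` no energy atom at any frame time** (stmt-25161 BY NAME ⇒ the statement of
stub `stub_noEnergyAtom` of `Cruxes/WeakLambdaCriterion/Lines/birth.lean`, crux stmt-19625, VERBATIM;
`noEnergyAtom_of_typeIIEnergyEquality`, p642579). Conditional on stmt-25161. [folklore] -/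
theorem noEnergyAtom_of_energyHalfHolder (hH : Theses.HalfHolderEnergy.EnergyHalfHolder) :
    ∀ (ν T : ℝ), 0 < ν → 0 < T →
      ∀ (u : ℝ → EuclideanSpace ℝ (Fin 3) → EuclideanSpace ℝ (Fin 3))
        (p : ℝ → EuclideanSpace ℝ (Fin 3) → ℝ),
        Literature.Analysis.FluidPDE.IsClassicalNSSolutionOn (Set.Ico 0 T) ν 0 u p →
        Literature.Analysis.FluidPDE.IsLerayHopfOn T ν 0 (u 0) u →
        Literature.Analysis.FluidPDE.HasRapidSpatialDecay (u 0) →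
        ∀ (x₀ : EuclideanSpace ℝ (Fin 3)) (η : NNReal), 0 < η →
          ∃ r : ℝ, 0 < r ∧ ∀ᶠ t in 𝓝[<] T,
            ∫⁻ x in Metric.ball x₀ r, ‖u t x‖ₑ ^ 2 < (η : ENNReal) :=
  noEnergyAtom_of_typeIIEnergyEquality (typeIIEnergyEquality_of_energyHalfHolder hH)

/-- **`EnergyHalfHolder ⇒` LERAY'S ENERGY EQUALITY on every closed frame interval `[0,T]`**
(`lerayEnergyEqualityEverywhere_of_typeIIEnergyEquality`, p642789). Conditional on stmt-25161. [folklore] -/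
theorem lerayEnergyEquality_of_energyHalfHolder (hH : Theses.HalfHolderEnergy.EnergyHalfHolder) :
    ∀ (ν T : ℝ), 0 < ν → 0 < T →
      ∀ (u : ℝ → EuclideanSpace ℝ (Fin 3) → EuclideanSpace ℝ (Fin 3))
        (p : ℝ → EuclideanSpace ℝ (Fin 3) → ℝ),
        Literature.Analysis.FluidPDE.IsClassicalNSSolutionOn (Set.Ico 0 T) ν 0 u p →
        Literature.Analysis.FluidPDE.IsLerayHopfOn T ν 0 (u 0) u →
        Literature.Analysis.FluidPDE.HasRapidSpatialDecay (u 0) →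
        VectorCalculus.kineticEnergy (u T) +
          ν * (∫⁻ τ in Set.Ioo 0 T, ∫⁻ x,
            ENNReal.ofReal (frobeniusNormSq (fderiv ℝ (u τ) x))).toReal =
          VectorCalculus.kineticEnergy (u 0) :=
  lerayEnergyEqualityEverywhere_of_typeIIEnergyEquality (typeIIEnergyEquality_of_energyHalfHolder hH)

end NoTerminalJolt

end Summit.NavierStokesRegularity.NavierStokesRegularity.Theorems

end
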